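import Summits.QuantumFields.YangMills.Theorems.CovarianceBound.Negative.FalseWithoutMinimalitySetup

/-!
# `CovarianceBound` — negative lemma: the restriction of the supremum to Coulomb MINIMISERS is load-bearing

Support file II for crux `stmt-QuantumFields-8780` (`ConvexGribovBody.CovarianceBound`), extracted from the
standing disprover's work file `Cruxes/CovarianceBound/Disproof.lean` (§A). Tree objects only; nothing is
posited; axioms `propext`, `Classical.choice`, `Quot.sound`. The deterministic half (twisted axial gauge
`hOf`, `gaugeTransform_hOf`, `le_cov_hOf : 2S+1 ≤ cov(U, hOf U, 0)`) is file I (`FalseWithoutMinimalitySetup`).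

* `CovarianceBoundWithoutMinimality` — verbatim the crux with the subtype `{h // h minimises coul(U,·)}`
  replaced by ALL gauge transformations `h : Site → G`.
* `not_covarianceBoundWithoutMinimality` — it is FALSE. Witness: `G = SU(2)`, fundamental `ρ`, `p = 0`, any
  `β`: the all-gauges supremum is a bounded lower-semicontinuous (hence integrable) function `≥ 2S+1`
  (file I), so its Wilson expectation is `≥ 2S+1` at every `β` (`integral_iSup_cov_zero_ge`) — unbounded in
  the volume, contradicting any `D(β)`.

MESSAGE FOR PROVERS. Any proof of `CovarianceBound` must use the minimising property of `h` QUANTITATIVELY,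
already at `p = 0`: over the full gauge orbit the zero-momentum "covariance" is `≥ 2S+1` (indeed
`≥ L(L-2)²`, `L = 2S+1`) for every single configuration, at every coupling. The gauge condition alone (lattice
transversality = first-order stationarity) does not see the constant mode at all (constant Lie-algebra
rotations telescope); what controls the `𝔤`-components of the zero mode on minimisers is GLOBAL minimality
against the winding competitors `y ↦ exp(2πi k y_j H / L) · h` (Zwanziger, Nucl. Phys. B364 (1991) 127),
which caps them at `O(L²)` and the `p = 0` integrand at `O(L)` configuration-wise — the remaining factor `L`
must come from the measure; the components of `½(ρ − ρᴴ)` outside `dρ(𝔤)` (trace part for `SU(N ≥ 3)`,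
higher harmonics for non-fundamental `ρ`) are invisible even to that comparison (work file §B).
-/

set_option autoImplicit false

namespace Summit.QuantumFields.YangMills.Theorems.CovarianceBound.Negative

open scoped Matrix ComplexConjugate
open MeasureTheory
open Literature.MathematicalPhysics.QuantumFieldTheory Literature.MathematicalPhysics.QuantumLattice

noncomputable section

variable {S : ℕ}

/-! ### Measure side: the zero-momentum all-gauges supremum is measurable, bounded, and `≥ 2S+1` -/

/-- For a fixed gauge transformation the zero-momentum integrand is continuous in the configuration. -/
theorem continuous_cov_zero (h : Site 4 (2 * S + 1) → SU2) :
    Continuous fun U : GaugeConfig 4 (2 * S + 1) SU2 => cov su2Fund S U h 0 := by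
  unfold cov fro
  simp only [phase_zero, one_smul, su2Fund_ρ]
  have hgt : ∀ e : Edge 4 (2 * S + 1), Continuous fun U : GaugeConfig 4 (2 * S + 1) SU2 =>
      ((gaugeTransform h U e : SU2) : Matrix (Fin 2) (Fin 2) ℂ) := fun e => by
    unfold gaugeTransform
    exact continuous_subtype_val.comp
      ((continuous_const.mul (continuous_apply e)).mul continuous_const)
  have hmat : ∀ j : Fin 3, Continuous fun U : GaugeConfig 4 (2 * S + 1) SU2 =>
      ∑ y : Fin 3 → ZMod (2 * S + 1), (1 / 2 : ℂ) •
        (((gaugeTransform h U (Fin.cons (0 : ZMod (2 * S + 1)) y, j.succ) : SU2) :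
          Matrix (Fin 2) (Fin 2) ℂ) -
          (((gaugeTransform h U (Fin.cons (0 : ZMod (2 * S + 1)) y, j.succ) : SU2) :
            Matrix (Fin 2) (Fin 2) ℂ))ᴴ) := fun j => by
    refine continuous_finsetSum _ fun y _ => ?_
    have h1 := hgt (Fin.cons (0 : ZMod (2 * S + 1)) y, j.succ)
    exact (h1.sub h1.matrix_conjTranspose).const_smul (1 / 2 : ℂ)
  exact (continuous_finsetSum _ fun j _ => continuous_finsetSum _ fun a _ =>
    continuous_finsetSum _ fun b _ => ((hmat j).matrix_elem a b).norm.pow 2).div_const _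

/-- The all-gauges family of zero-momentum integrands is bounded above (by `12 L⁶`). -/
theorem bddAbove_cov_zero (U : GaugeConfig 4 (2 * S + 1) SU2) :
    BddAbove (Set.range fun h : Site 4 (2 * S + 1) → SU2 => cov su2Fund S U h 0) :=
  ⟨12 * ((2 * S + 1 : ℝ) ^ 3) ^ 2, by rintro _ ⟨h, rfl⟩; exact cov_zero_le U h⟩

/-- The all-gauges supremum is lower semicontinuous, hence Borel measurable (`G^{E}` is second
countable, so the product σ-algebra is the Borel one). -/
theorem measurable_iSup_cov_zero :
    Measurable fun U : GaugeConfig 4 (2 * S + 1) SU2 =>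
      ⨆ h : Site 4 (2 * S + 1) → SU2, cov su2Fund S U h 0 :=
  (lowerSemicontinuous_ciSup (f := fun (h : Site 4 (2 * S + 1) → SU2)
      (U : GaugeConfig 4 (2 * S + 1) SU2) => cov su2Fund S U h 0)
    bddAbove_cov_zero fun h => (continuous_cov_zero h).lowerSemicontinuous).measurable

/-- Upper bound `12 L⁶` for the all-gauges supremum. -/
theorem iSup_cov_zero_le (U : GaugeConfig 4 (2 * S + 1) SU2) :
    (⨆ h : Site 4 (2 * S + 1) → SU2, cov su2Fund S U h 0) ≤ 12 * ((2 * S + 1 : ℝ) ^ 3) ^ 2 :=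
  ciSup_le fun h => cov_zero_le U h

/-- Lower bound `2S+1` for the all-gauges supremum, configuration-wise. -/
theorem le_iSup_cov_zero (hS : 1 ≤ S) (U : GaugeConfig 4 (2 * S + 1) SU2) :
    (2 * S + 1 : ℝ) ≤ ⨆ h : Site 4 (2 * S + 1) → SU2, cov su2Fund S U h 0 :=
  (le_cov_hOf hS U).trans (le_ciSup (bddAbove_cov_zero U) (hOf U))

/-- **Measure-side lower bound.** For `SU(2)` in the fundamental representation, at EVERY coupling
`β` and on EVERY torus `(2S+1)⁴` with `S ≥ 1`, the Wilson expectation of the zero-momentum integrand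
with the supremum taken over all gauge transformations is at least `2S + 1`. -/
theorem integral_iSup_cov_zero_ge (hS : 1 ≤ S) (β : ℝ) :
    (2 * S + 1 : ℝ) ≤ ∫ U, (⨆ h : Site 4 (2 * S + 1) → SU2, cov su2Fund S U h 0)
      ∂(wilsonMeasure (d := 4) (L := 2 * S + 1) su2Fund.ρ β) := by
  haveI := isProbabilityMeasure_wilsonMeasure (d := 4) (L := 2 * S + 1) su2Fund.ρ
    su2Fund.continuous β
  have hint : Integrable (fun U : GaugeConfig 4 (2 * S + 1) SU2 =>
      ⨆ h : Site 4 (2 * S + 1) → SU2, cov su2Fund S U h 0)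
      (wilsonMeasure (d := 4) (L := 2 * S + 1) su2Fund.ρ β) := by
    refine (integrable_const (12 * ((2 * S + 1 : ℝ) ^ 3) ^ 2)).mono'
      measurable_iSup_cov_zero.aestronglyMeasurable (ae_of_all _ fun U => ?_)
    rw [Real.norm_eq_abs, abs_of_nonneg
      (le_trans (by positivity : (0 : ℝ) ≤ 2 * S + 1) (le_iSup_cov_zero hS U))]
    exact iSup_cov_zero_le U
  calc (2 * S + 1 : ℝ)
      = ∫ _U, (2 * S + 1 : ℝ) ∂(wilsonMeasure (d := 4) (L := 2 * S + 1) su2Fund.ρ β) := by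
        rw [integral_const, probReal_univ, one_smul]
    _ ≤ _ := integral_mono (integrable_const _) hint fun U => le_iSup_cov_zero hS U

/-! ### The crux with minimality dropped, and its refutation -/

/-- `CovarianceBound` WITHOUT MINIMALITY: verbatim the crux
`Summit.QuantumFields.YangMills.Theses.ConvexGribovBody.CovarianceBound` except that the supremum
inside the integral runs over ALL gauge transformations `h : Site → G` of the configuration instead
of the absolute minimisers `{h // ∀ h', coul U h ≤ coul U h'}` of the slice Coulomb functional (the
then-unused `let coul` is omitted). -/
def CovarianceBoundWithoutMinimality : Prop :=
  ∀ (G : Type) [Group G] [TopologicalSpace G] [IsTopologicalGroup G] [CompactSpace G] [MeasurableSpace G] [BorelSpace G], IsCompactSimpleLieGroup G → ∀ r : LatticeRep G, ∃ β₀ : ℝ, ∀ β : ℝ, β₀ ≤ β → ∃ D : ℝ, 0 < D ∧ ∃ S₀ : ℕ, ∀ S : ℕ, S₀ ≤ S → let μ := wilsonMeasure (d := 4) (L := 2 * S + 1) r.ρ β; let fro : Matrix (Fin r.N) (Fin r.N) ℂ → ℝ := fun M => ∑ a, ∑ b, ‖M a b‖ ^ 2; let cov : GaugeConfig 4 (2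 * S + 1) G → (Site 4 (2 * S + 1) → G) → (Fin 3 → ZMod (2 * S + 1)) → ℝ := fun U h p => (∑ j : Fin 3, fro (∑ y : Fin 3 → ZMod (2 * S + 1), Complex.exp (-(2 * Real.pi * Complex.I * (∑ i : Fin 3, ((p i).val : ℂ) * ((y i).val : ℂ)) / (2 * S + 1 : ℂ))) • ((1 / 2 : ℂ) • (r.ρ (gaugeTransform h U (Fin.cons (0 : ZMod (2 * S + 1)) y, j.succ)) - (r.ρ (gaugeTransform h U (Fin.cons (0 : ZMod (2 * S + 1)) y, j.succ)))ᴴ)))) / ((2 * S + 1 : ℝ) ^ 3); ∀ p : Fin 3 → ZMod (2 * S + 1), ∫ U, (⨆ h : Site 4 (2 * S + 1) → G, cov U h p) ∂μ ≤ D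

/-- **`CovarianceBound` is false without minimality** — any proof of the crux must use the
minimising property of `h` quantitatively, already at zero momentum: for `G = SU(2)` in the
fundamental representation the all-gauges zero-momentum expectation is `≥ 2S+1` at every `β`
(`integral_iSup_cov_zero_ge`), so no volume-uniform `D` exists. -/
theorem not_covarianceBoundWithoutMinimality : ¬ CovarianceBoundWithoutMinimality := by
  intro H
  obtain ⟨β₀, hβ⟩ := H SU2 isCompactSimpleLieGroup_SU2 su2Fund
  obtain ⟨D, -, S₀, hS₀⟩ := hβ β₀ le_rfl
  set S : ℕ := max (max S₀ 1) ⌈D⌉₊ with hSdef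
  have hS₀S : S₀ ≤ S := le_trans (le_max_left _ _) (le_max_left _ _)
  have h1S : 1 ≤ S := le_trans (le_max_right _ _) (le_max_left _ _)
  have hDS : D ≤ (S : ℝ) := le_trans (Nat.le_ceil D) (by exact_mod_cast le_max_right _ _)
  have h := hS₀ S hS₀S
  have h0 : ∫ U, (⨆ h : Site 4 (2 * S + 1) → SU2, cov su2Fund S U h 0)
      ∂(wilsonMeasure (d := 4) (L := 2 * S + 1) su2Fund.ρ β₀) ≤ D := by
    simpa [cov, fro] using h 0
  have := integral_iSup_cov_zero_ge h1S β₀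
  linarith

end

end Summit.QuantumFields.YangMills.Theorems.CovarianceBound.Negative
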